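import Literature.Analysis.Calculus.SmoothAlongExp
import Mathlib.Analysis.Calculus.FDeriv.Mul
import Mathlib.Analysis.Calculus.ContDiff.Operations
import Mathlib.Algebra.BigOperators.Group.List.Lemmas
import HarnessLib

/-!
# Canonical coordinates of the second kind: `s ↦ exp (s₀ X₀) · exp (s₁ X₁) ⋯ exp (s_{d-1} X_{d-1})`

Topic `Analysis/Calculus`; namespace `Literature.Analysis.Calculus`.  One definition with body (`expOfFnProd`) and proved theorems;
no named fact, no instance, no notation, no `sorry`.  Setting (as ★ `SmoothAlongExp` ∕ ★ `UnitsSmoothFlow`): `A` a real Banach algebra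
(`[NormedRing A] [NormedAlgebra ℝ A] [CompleteSpace A]`; in the applications `A = M_N(L ⊗ ℝ)`), `exp = NormedSpace.exp`.

For a finite family `X : Fin d → A` (a frame of a Lie subalgebra in the applications) the **coordinates of the second kind** are
`expOfFnProd X s := (List.ofFn fun j => exp (s j • X j)).prod = exp (s 0 • X 0) * exp (s 1 • X 1) * ⋯` (`s : Fin d → ℝ`).  We prove:

* §1 algebra: `expOfFnProd_def`, `expOfFnProd_fin_zero` (`d = 0`: the empty product is `1`), the `Fin.succ` recursion `expOfFnProd_succ`
  (`= exp (s 0 • X 0) * expOfFnProd (X ∘ succ) (s ∘ succ)`), `expOfFnProd_zero` (`s = 0 ↦ 1`), `isUnit_expOfFnProd`, `expOfFnProd_single`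
  (`s = Pi.single j t ↦ exp (t • X j)`);
* §2 calculus: `contDiff_expOfFnProd : ContDiff ℝ n (expOfFnProd X)` (every `n`, in particular `∞`), `continuous_expOfFnProd`,
  **`hasStrictFDerivAt_expOfFnProd_zero : HasStrictFDerivAt (expOfFnProd X) (∑ j, (ContinuousLinearMap.proj j : (Fin d → ℝ) →L[ℝ] ℝ).smulRight (X j)) 0`** — the
  differential at the origin is `v ↦ ∑ j, v j • X j` (product rule along `List.ofFn_succ`, every factor equals `1` at `s = 0`, and
  `d/du exp (u • X) |_{u=0} = X` by Mathlib `hasStrictDerivAt_exp_smul_const`) — with the `HasFDerivAt` and `fderiv` forms.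

This is sub-brick (B6a) of the road «DM∞» (F0∕P3, `F0/P3/p03/CENSUS-DMinf.F0P3p03g8.md`): the archimedean Dixmier–Malliavin factorisation for
`U(H)(L⁺ ⊗ ℝ)` [DixmierMalliavin1978, §3 Thm. 3.1] parametrises a neighbourhood of `1` in the Lie group by coordinates of the second kind and
integrates the one-parameter steps direction by direction; the strict derivative at `0` is the input of the inverse function theorem in (B6b).
Nothing here is specific to unitary groups; HC_CM is proved only modulo the printed citations until rung 0 closes, and this file introduces no debt.

## References
* J. Dixmier, P. Malliavin, *Factorisations de fonctions et de vecteurs indéfiniment différentiables*, Bull. Sci. Math. 102 (1978), §3 Thm. 3.1. [DixmierMalliavin1978]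
* A. W. Knapp, *Lie Groups Beyond an Introduction*, 2nd ed. (2002), Chap. I §10 (one-parameter groups `t ↦ exp tX` in matrix groups; products of such
  as local coordinates). [Knapp2002]
-/

set_option autoImplicit false

noncomputable section

open NormedSpace Filter Set Function
open scoped Topology ContDiff

namespace Literature.Analysis.Calculus

variable {A : Type*} [NormedRing A] [NormedAlgebra ℝ A]

/-! ## §1 The product of one-parameter exponentials -/

/-- **Coordinates of the second kind**: `expOfFnProd X s = exp (s 0 • X 0) * exp (s 1 • X 1) * ⋯ * exp (s (d-1) • X (d-1))`, the ordered product of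
the one-parameter exponentials along the family `X : Fin d → A`. [cite: Knapp2002, Chap. I §10] [cite: DixmierMalliavin1978, §3 Thm. 3.1] -/
def expOfFnProd {d : ℕ} (X : Fin d → A) (s : Fin d → ℝ) : A :=
  (List.ofFn fun j => exp (s j • X j)).prod

/-- unfolding (definitional). [cite: Knapp2002, Chap. I §10] -/
theorem expOfFnProd_def {d : ℕ} (X : Fin d → A) (s : Fin d → ℝ) :
    expOfFnProd X s = (List.ofFn fun j => exp (s j • X j)).prod := rfl

/-- the empty product (`d = 0`) is `1`. [cite: Knapp2002, Chap. I §10] -/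
@[simp] theorem expOfFnProd_fin_zero (X : Fin 0 → A) (s : Fin 0 → ℝ) : expOfFnProd X s = 1 := by
  simp [expOfFnProd_def]

/-- **the `Fin.succ` recursion**: `expOfFnProd X s = exp (s 0 • X 0) * expOfFnProd (X ∘ succ) (s ∘ succ)`. [cite: Knapp2002, Chap. I §10] -/
theorem expOfFnProd_succ {d : ℕ} (X : Fin (d + 1) → A) (s : Fin (d + 1) → ℝ) :
    expOfFnProd X s = exp (s 0 • X 0) * expOfFnProd (fun j => X j.succ) (fun j => s j.succ) := by
  simp [expOfFnProd_def, List.ofFn_succ]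

/-- the recursion as an identity of functions of `s`. [cite: Knapp2002, Chap. I §10] -/
theorem expOfFnProd_succ_eq {d : ℕ} (X : Fin (d + 1) → A) :
    expOfFnProd X = fun s => exp (s 0 • X 0) * expOfFnProd (fun j => X j.succ) (fun j => s j.succ) :=
  funext fun s => expOfFnProd_succ X s

/-- `exp x` is a unit in a complete real normed algebra (Mathlib `isUnit_exp_of_mem_ball` at radius `∞`; the `ℚ`-algebra form
`NormedSpace.isUnit_exp` is not available for a general real Banach algebra). [cite: Knapp2002, Chap. I §10] -/
theorem isUnit_exp_real [CompleteSpace A] (x : A) : IsUnit (exp x) :=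
  isUnit_exp_of_mem_ball (𝕂 := ℝ) ((expSeries_radius_eq_top ℝ A).symm ▸ edist_lt_top _ _)

/-- every factor is a unit, hence so is the product. [cite: Knapp2002, Chap. I §10] -/
theorem isUnit_expOfFnProd [CompleteSpace A] {d : ℕ} (X : Fin d → A) (s : Fin d → ℝ) : IsUnit (expOfFnProd X s) := by
  rw [expOfFnProd_def]
  refine List.prod_isUnit fun m hm => ?_
  rw [List.mem_ofFn] at hm
  obtain ⟨j, rfl⟩ := hm
  exact isUnit_exp_real _

/-- membership: if a submonoid contains every factor `exp (s j • X j)` it contains the product (e.g. the group generated by the one-parameter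
subgroups, or a closed subgroup containing them). [cite: Knapp2002, Chap. I §10] -/
theorem expOfFnProd_mem {d : ℕ} (X : Fin d → A) (s : Fin d → ℝ) {S : Submonoid A} (h : ∀ j, exp (s j • X j) ∈ S) :
    expOfFnProd X s ∈ S := by
  rw [expOfFnProd_def]
  refine list_prod_mem fun m hm => ?_
  rw [List.mem_ofFn] at hm
  obtain ⟨j, rfl⟩ := hm
  exact h j

/-- at `s = 0` every factor is `exp 0 = 1`. [cite: Knapp2002, Chap. I §10] -/
@[simp] theorem expOfFnProd_zero {d : ℕ} (X : Fin d → A) : expOfFnProd X 0 = 1 := by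
  induction d with
  | zero => simp
  | succ d ih =>
    rw [expOfFnProd_succ]
    simp only [Pi.zero_apply, zero_smul, exp_zero, one_mul]
    exact ih _

/-- `expOfFnProd_zero` with the zero function spelled `fun _ => 0` (the form produced by the `Fin.succ` recursion). [cite: Knapp2002, Chap. I §10] -/
@[simp] theorem expOfFnProd_zero' {d : ℕ} (X : Fin d → A) : expOfFnProd X (fun _ => 0) = 1 :=
  expOfFnProd_zero X

/-- along the `j`-th coordinate axis only the `j`-th factor survives: `expOfFnProd X (Pi.single j t) = exp (t • X j)`. [cite: Knapp2002, Chap. I §10] -/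
theorem expOfFnProd_single {d : ℕ} (X : Fin d → A) (j : Fin d) (t : ℝ) :
    expOfFnProd X (Pi.single j t) = exp (t • X j) := by
  induction d with
  | zero => exact j.elim0
  | succ d ih =>
    rw [expOfFnProd_succ]
    refine Fin.cases ?_ (fun i => ?_) j
    · have h0 : (fun i : Fin d => (Pi.single (0 : Fin (d + 1)) t : Fin (d + 1) → ℝ) i.succ) = 0 := by
        funext i; simp [Fin.succ_ne_zero]
      rw [h0, expOfFnProd_zero]; simp
    · have h1 : (Pi.single i.succ t : Fin (d + 1) → ℝ) 0 = 0 := by simp [(Fin.succ_ne_zero i).symm]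
      have h2 : (fun k : Fin d => (Pi.single i.succ t : Fin (d + 1) → ℝ) k.succ) = Pi.single i t := by
        funext k; simp [Pi.single_apply, Fin.succ_inj]
      rw [h1, h2, ih]; simp

/-! ## §2 Smoothness and the differential at the origin -/

/-- the one-parameter factor `s ↦ exp (s j • X j)` is `C^n` in `s : Fin d → ℝ`. [cite: Knapp2002, Chap. I §10] -/
theorem contDiff_exp_apply_smul [CompleteSpace A] {d : ℕ} {n : WithTop ℕ∞} (X : Fin d → A) (j : Fin d) :
    ContDiff ℝ n (fun s : Fin d → ℝ => exp (s j • X j)) :=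
  (contDiff_iff_contDiffAt.2 fun x => contDiffAt_exp x).comp ((contDiff_apply ℝ ℝ j).smul contDiff_const)

/-- **`expOfFnProd X` is smooth** (every `C^n`). [cite: DixmierMalliavin1978, §3 Thm. 3.1] [cite: Knapp2002, Chap. I §10] -/
theorem contDiff_expOfFnProd [CompleteSpace A] {d : ℕ} {n : WithTop ℕ∞} (X : Fin d → A) : ContDiff ℝ n (expOfFnProd X) := by
  induction d with
  | zero =>
    have h : expOfFnProd X = fun _ => (1 : A) := funext fun s => expOfFnProd_fin_zero X s
    rw [h]; exact contDiff_const
  | succ d ih =>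
    rw [expOfFnProd_succ_eq]
    refine (contDiff_exp_apply_smul X 0).mul ?_
    exact (ih (fun j => X j.succ)).comp (contDiff_pi.2 fun j => contDiff_apply ℝ ℝ j.succ)

/-- `expOfFnProd X` is continuous. [cite: Knapp2002, Chap. I §10] -/
theorem continuous_expOfFnProd [CompleteSpace A] {d : ℕ} (X : Fin d → A) : Continuous (expOfFnProd X) :=
  (contDiff_expOfFnProd (n := 0) X).continuous

/-- the strict derivative of the one-parameter factor `s ↦ exp (s j • X j)` at `s = 0` is `v ↦ v j • X j`. [cite: Knapp2002, Chap. I §10] -/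
theorem hasStrictFDerivAt_exp_apply_smul_zero [CompleteSpace A] {d : ℕ} (X : Fin d → A) (j : Fin d) :
    HasStrictFDerivAt (fun s : Fin d → ℝ => exp (s j • X j)) ((ContinuousLinearMap.proj j : (Fin d → ℝ) →L[ℝ] ℝ).smulRight (X j)) 0 := by
  have h1 : HasStrictFDerivAt (fun u : ℝ => exp (u • X j))
      ((ContinuousLinearMap.smulRight (1 : ℝ →L[ℝ] ℝ) (exp ((0 : ℝ) • X j) * X j))) 0 :=
    (hasStrictDerivAt_exp_smul_const (𝕂 := ℝ) (X j) 0).hasStrictFDerivAt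
  have h2 : HasStrictFDerivAt (fun s : Fin d → ℝ => s j) (ContinuousLinearMap.proj j) (0 : Fin d → ℝ) :=
    (ContinuousLinearMap.proj (R := ℝ) (φ := fun _ : Fin d => ℝ) j).hasStrictFDerivAt
  have h3 := h1.comp (0 : Fin d → ℝ) h2
  refine h3.congr_fderiv ?_
  ext v
  simp

/-- **THE DIFFERENTIAL AT THE ORIGIN (strict form)**: `D(expOfFnProd X)(0)[v] = ∑ j, v j • X j`. [cite: DixmierMalliavin1978, §3 Thm. 3.1] [cite: Knapp2002, Chap. I §10] -/
theorem hasStrictFDerivAt_expOfFnProd_zero [CompleteSpace A] {d : ℕ} (X : Fin d → A) :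
    HasStrictFDerivAt (expOfFnProd X) (∑ j, (ContinuousLinearMap.proj j : (Fin d → ℝ) →L[ℝ] ℝ).smulRight (X j)) 0 := by
  induction d with
  | zero =>
    have h : expOfFnProd X = fun _ => (1 : A) := funext fun s => expOfFnProd_fin_zero X s
    rw [h]; simp only [Finset.univ_eq_empty, Finset.sum_empty]
    exact hasStrictFDerivAt_const (1 : A) 0
  | succ d ih =>
    rw [expOfFnProd_succ_eq]
    -- the tail as a composite with the (linear) restriction `s ↦ s ∘ succ`
    have hL : HasStrictFDerivAt (fun s : Fin (d + 1) → ℝ => fun j : Fin d => s j.succ)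
        (ContinuousLinearMap.pi fun j : Fin d => ContinuousLinearMap.proj (R := ℝ) (φ := fun _ : Fin (d + 1) => ℝ) j.succ)
        (0 : Fin (d + 1) → ℝ) :=
      (ContinuousLinearMap.pi fun j : Fin d =>
        ContinuousLinearMap.proj (R := ℝ) (φ := fun _ : Fin (d + 1) => ℝ) j.succ).hasStrictFDerivAt
    have htail := (ih (fun j => X j.succ)).comp (0 : Fin (d + 1) → ℝ) hL
    have hhead := hasStrictFDerivAt_exp_apply_smul_zero X 0
    have hprod := hhead.mul' htail
    refine hprod.congr_fderiv ?_
    ext v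
    simpa [Fin.sum_univ_succ] using add_comm _ _

/-- **THE DIFFERENTIAL AT THE ORIGIN**: `HasFDerivAt (expOfFnProd X) (∑ j, (proj j).smulRight (X j)) 0`. [cite: DixmierMalliavin1978, §3 Thm. 3.1] [cite: Knapp2002, Chap. I §10] -/
theorem hasFDerivAt_expOfFnProd_zero [CompleteSpace A] {d : ℕ} (X : Fin d → A) :
    HasFDerivAt (expOfFnProd X) (∑ j, (ContinuousLinearMap.proj j : (Fin d → ℝ) →L[ℝ] ℝ).smulRight (X j)) 0 :=
  (hasStrictFDerivAt_expOfFnProd_zero X).hasFDerivAt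

/-- the `fderiv` form of the differential at the origin. [cite: Knapp2002, Chap. I §10] -/
theorem fderiv_expOfFnProd_zero [CompleteSpace A] {d : ℕ} (X : Fin d → A) :
    fderiv ℝ (expOfFnProd X) 0 = ∑ j, (ContinuousLinearMap.proj j : (Fin d → ℝ) →L[ℝ] ℝ).smulRight (X j) :=
  (hasFDerivAt_expOfFnProd_zero X).fderiv

/-- the differential at the origin evaluated: `D(expOfFnProd X)(0) v = ∑ j, v j • X j`. [cite: Knapp2002, Chap. I §10] -/
theorem fderiv_expOfFnProd_zero_apply [CompleteSpace A] {d : ℕ} (X : Fin d → A) (v : Fin d → ℝ) :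
    fderiv ℝ (expOfFnProd X) 0 v = ∑ j, v j • X j := by
  rw [fderiv_expOfFnProd_zero]
  simp

/-- `expOfFnProd X` is differentiable (everywhere). [cite: Knapp2002, Chap. I §10] -/
theorem differentiable_expOfFnProd [CompleteSpace A] {d : ℕ} (X : Fin d → A) : Differentiable ℝ (expOfFnProd X) :=
  (contDiff_expOfFnProd (n := 1) X).differentiable one_ne_zero

/-- `expOfFnProd X` has a strict derivative at every point (it is `C¹`). [cite: Knapp2002, Chap. I §10] -/
theorem hasStrictFDerivAt_expOfFnProd [CompleteSpace A] {d : ℕ} (X : Fin d → A) (s : Fin d → ℝ) :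
    HasStrictFDerivAt (expOfFnProd X) (fderiv ℝ (expOfFnProd X) s) s :=
  (contDiff_expOfFnProd (n := 1) X).contDiffAt.hasStrictFDerivAt one_ne_zero

end Literature.Analysis.Calculus

end
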